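import Mathlib
import Summits.Ventures.PercRepro2.SwOutMixedArmsBase

/-!
# The several-arms big-block lemma: the far arms by induction (blind cell PercRepro2, night-4 g20,
2026-08-27; proofs/NIGHT4-G20.md §4)

**Theorem** `mixedArms_card_le`: for every lower set `Q` of the several-arms raw cube with `G5` and
every up-set `𝓔` of atom sets, the non-leaking part of `Q` satisfies the rigid counting
inequality `#{ER ∈ 𝓔} ≤ #{EB ∈ 𝓔}`.  The far arms are peeled off exactly as in
`MixedPieces.face_card_le` (`SwOutMixedPiecesThm`): the levels `level0 ⊇ level1` of a far arm
`k`, the shifted up-set `𝓔₁ = {S : insert F_k S ∈ 𝓔}`, the induction hypothesis twice; the base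
`T = ∅` is `face_empty_card_le` (`SwOutMixedArmsBase`).
-/

namespace Summit.Ventures.PercRepro2

namespace MixedArms

open scoped Classical

variable {ι ρ ν κ : Type*}

section SetF

variable [DecidableEq κ]

/-- Set the far-arm coordinate `k` of a point to `b`. -/
def setF (p : PtR ι ρ ν κ) (k : κ) (b : Bool) : PtR ι ρ ν κ :=
  (p.1, p.2.1, p.2.2.1, p.2.2.2.1, Function.update p.2.2.2.2 k b)

/-- Leaking does not see the far arms. -/
lemma leak_setF (arm : ν → ρ) (p : PtR ι ρ ν κ) (k : κ) (b : Bool) :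
    Leak (setF p k b) arm ↔ Leak p arm := Iff.rfl

/-- Setting a coordinate twice. -/
lemma setF_setF (p : PtR ι ρ ν κ) (k : κ) (b b' : Bool) : setF (setF p k b) k b' = setF p k b' := by
  simp only [setF, Function.update_idem]

/-- Setting a coordinate to its value. -/
lemma setF_eq_self {p : PtR ι ρ ν κ} {k : κ} {b : Bool} (h : p.2.2.2.2 k = b) : setF p k b = p := by
  subst h
  obtain ⟨s, a, uP, e, f⟩ := p
  simp only [setF, Function.update_eq_self]

/-- The far-arm coordinate after setting. -/
lemma setF_apply_same (p : PtR ι ρ ν κ) (k : κ) (b : Bool) : (setF p k b).2.2.2.2 k = b := by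
  simp only [setF, Function.update_self]

/-- The other far-arm coordinates after setting. -/
lemma setF_apply_of_ne (p : PtR ι ρ ν κ) {k k' : κ} (h : k' ≠ k) (b : Bool) :
    (setF p k b).2.2.2.2 k' = p.2.2.2.2 k' := by
  simp only [setF, Function.update_of_ne h]

/-- Setting a coordinate to `true` adds the far arm to the red set. -/
lemma ER_setF_true (p : PtR ι ρ ν κ) (k : κ) :
    ER (setF p k true) = insert (fA k) (ER p) := by
  ext x
  rw [Set.mem_insert_iff]
  rcases x with j | ⟨⟨⟩⟩ | i | r | k'
  · rw [mem_ER_inl, mem_ER_inl]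
    simp only [setF, fA, reduceCtorEq, false_or]
  · rw [mem_ER_u, mem_ER_u]
    simp only [setF, fA, Sum.inr.injEq, reduceCtorEq, false_or]
  · rw [mem_ER_a, mem_ER_a]
    simp only [setF, fA, Sum.inr.injEq, reduceCtorEq, false_or]
  · rw [mem_ER_p, mem_ER_p]
    simp only [setF, fA, Sum.inr.injEq, reduceCtorEq, false_or]
  · rw [mem_ER_f, mem_ER_f]
    simp only [setF, fA, Sum.inr.injEq, Function.update_apply]
    by_cases h : k' = k
    · subst h
      simp
    · simp [h]

/-- `setF` is monotone in the point. -/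
lemma setF_mono {p q : PtR ι ρ ν κ} (h : p ≤ q) (k : κ) (b : Bool) : setF p k b ≤ setF q k b := by
  obtain ⟨hs, ha, hu, he, hf⟩ := h
  refine ⟨hs, ha, hu, he, fun k' => ?_⟩
  by_cases hk : k' = k
  · subst hk
    simp only [setF, Function.update_self, le_refl]
  · simp only [setF, Function.update_of_ne hk]
    exact hf k'

/-- A point is below its `true`-setting. -/
lemma le_setF_true (p : PtR ι ρ ν κ) (k : κ) : p ≤ setF p k true := by
  refine ⟨le_rfl, le_rfl, le_rfl, le_rfl, fun k' => ?_⟩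
  by_cases hk : k' = k
  · subst hk
    simp only [setF, Function.update_self, Bool.le_true]
  · simp only [setF, Function.update_of_ne hk, le_refl]

/-- Setting a far arm commutes with the partial flip off the set. -/
lemma flipT_insert_of_false {T : Finset κ} {k : κ} (hk : k ∉ T) {p : PtR ι ρ ν κ}
    (hp : p.2.2.2.2 k = false) : flipT (insert k T) p = setF (flipT T p) k true := by
  refine Prod.ext rfl (Prod.ext rfl (Prod.ext rfl (Prod.ext rfl ?_)))
  funext k'
  by_cases h : k' = k
  · subst h
    simp only [flipT, setF, Finset.mem_insert, true_or, if_true, hp, Bool.not_false,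
      Function.update_self]
  · simp only [flipT, setF, Finset.mem_insert, h, false_or, Function.update_of_ne h]

/-- The partial flip of a `true`-setting off the set. -/
lemma flipT_insert_setF_true {T : Finset κ} {k : κ} (hk : k ∉ T) {p : PtR ι ρ ν κ}
    (hp : p.2.2.2.2 k = false) : flipT (insert k T) (setF p k true) = flipT T p := by
  refine Prod.ext rfl (Prod.ext rfl (Prod.ext rfl (Prod.ext rfl ?_)))
  funext k'
  by_cases h : k' = k
  · subst h
    simp only [flipT, setF, Finset.mem_insert, true_or, if_true, hk, if_false, hp,
      Function.update_self, Bool.not_true]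
  · simp only [flipT, setF, Finset.mem_insert, h, false_or, Function.update_of_ne h]

end SetF

section Levels

variable [DecidableEq κ] (Q : Set (PtR ι ρ ν κ)) (k : κ)

/-- Level zero: the points of `Q` with the far arm `k` blue. -/
def level0 : Set (PtR ι ρ ν κ) := {p | p ∈ Q ∧ p.2.2.2.2 k = false}

/-- Level one: the points with the far arm `k` blue whose `true`-setting lies in `Q`. -/
def level1 : Set (PtR ι ρ ν κ) := {p | p.2.2.2.2 k = false ∧ setF p k true ∈ Q}

variable {Q k}

omit [DecidableEq κ] in
/-- Level zero is a lower set. -/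
lemma isLowerSet_level0 (hQ : IsLowerSet Q) : IsLowerSet (level0 Q k) := by
  rintro p q hle ⟨hp, hk⟩
  refine ⟨hQ hle hp, ?_⟩
  have := hle.2.2.2.2 k
  rw [hk] at this
  cases h : q.2.2.2.2 k
  · rfl
  · rw [h] at this
    exact absurd (MixedPieces.true_le_imp this rfl) Bool.false_ne_true

/-- Level one is a lower set. -/
lemma isLowerSet_level1 (hQ : IsLowerSet Q) : IsLowerSet (level1 Q k) := by
  rintro p q hle ⟨hk, hp⟩
  refine ⟨?_, hQ (setF_mono hle k true) hp⟩
  have := hle.2.2.2.2 k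
  rw [hk] at this
  cases h : q.2.2.2.2 k
  · rfl
  · rw [h] at this
    exact absurd (MixedPieces.true_le_imp this rfl) Bool.false_ne_true

omit [DecidableEq κ] in
/-- `G5` passes to level zero. -/
lemma G5_level0 (hG : G5 Q) : G5 (level0 Q k) := by
  rintro a e f ⟨h, hk⟩
  exact ⟨hG a e f h, hk⟩

/-- `G5` passes to level one. -/
lemma G5_level1 (hG : G5 Q) : G5 (level1 Q k) := by
  rintro a e f ⟨hk, h⟩
  exact ⟨hk, hG a e _ h⟩

/-- Level one lies in level zero. -/
lemma level1_subset_level0 (hQ : IsLowerSet Q) : level1 Q k ⊆ level0 Q k := by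
  rintro p ⟨hk, hp⟩
  exact ⟨hQ (le_setF_true p k) hp, hk⟩

/-- Level zero lies on the smaller face. -/
lemma level0_subset_face {T : Finset κ} (hf : Q ⊆ face (insert k T)) :
    level0 Q k ⊆ face T := by
  rintro p ⟨hp, hk⟩ k' hk'
  by_cases h : k' = k
  · rw [h]
    exact hk
  · exact hf hp k' (by simp only [Finset.mem_insert, not_or]; exact ⟨h, hk'⟩)

/-- Level one lies on the smaller face. -/
lemma level1_subset_face {T : Finset κ} (hf : Q ⊆ face (insert k T)) :
    level1 Q k ⊆ face T := by
  rintro p ⟨hk, hp⟩ k' hk'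
  by_cases h : k' = k
  · rw [h]
    exact hk
  · have := hf hp k' (by simp only [Finset.mem_insert, not_or]; exact ⟨h, hk'⟩)
    rwa [setF_apply_of_ne p h] at this

end Levels

section Counting

variable [Nonempty ι] [Fintype ι] [DecidableEq ι] [Fintype ρ] [DecidableEq ρ] [Fintype ν]
  [DecidableEq ν] [Fintype κ] [DecidableEq κ] {arm : ν → ρ}

omit [Nonempty ι] in
/-- Splitting a count by a finer predicate. -/
lemma N_split_pred_sub {A B : PtR ι ρ ν κ → Prop} (hAB : ∀ p, A p → B p) :
    N B = N A + N (fun p => B p ∧ ¬ A p) := by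
  rw [N_split_pred B A]
  congr 1
  apply N_congr
  intro p
  exact ⟨fun h => h.2, fun h => ⟨hAB p h, h⟩⟩

variable {Q : Set (PtR ι ρ ν κ)} {k : κ}

omit [Nonempty ι] in
/-- The points of `Q` with the far arm `k` red, counted on level one. -/
lemma N_level1_eq (R : PtR ι ρ ν κ → Prop) :
    N (fun p : PtR ι ρ ν κ => (p ∈ Q ∧ ¬ Leak p arm ∧ R p) ∧ ¬ p.2.2.2.2 k = false) =
      N (fun p : PtR ι ρ ν κ => p ∈ level1 Q k ∧ ¬ Leak p arm ∧ R (setF p k true)) := by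
  unfold N
  refine Finset.card_bij' (fun p _ => setF p k false) (fun p _ => setF p k true) ?_ ?_ ?_ ?_
  · intro p hp
    simp only [Finset.mem_filter, Finset.mem_univ, true_and, Bool.not_eq_false] at hp
    obtain ⟨⟨hQ, hL, hR⟩, hk⟩ := hp
    simp only [Finset.mem_filter, Finset.mem_univ, true_and, level1, Set.mem_setOf_eq,
      setF_apply_same, setF_setF, setF_eq_self hk, leak_setF arm]
    exact ⟨hQ, hL, hR⟩
  · intro p hp
    simp only [Finset.mem_filter, Finset.mem_univ, true_and, level1, Set.mem_setOf_eq] at hp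
    obtain ⟨⟨hk, hQ⟩, hL, hR⟩ := hp
    simp only [Finset.mem_filter, Finset.mem_univ, true_and, leak_setF, setF_apply_same,
      Bool.not_eq_false, and_true]
    exact ⟨hQ, hL, hR⟩
  · intro p hp
    simp only [Finset.mem_filter, Finset.mem_univ, true_and, Bool.not_eq_false] at hp
    rw [setF_setF, setF_eq_self hp.2]
  · intro p hp
    simp only [Finset.mem_filter, Finset.mem_univ, true_and, level1, Set.mem_setOf_eq] at hp
    rw [setF_setF, setF_eq_self hp.1.1]

omit [Nonempty ι] in
/-- The non-leaking points of `Q`, counted by the two levels of the far arm `k`. -/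
lemma N_levels (R : PtR ι ρ ν κ → Prop) :
    N (fun p : PtR ι ρ ν κ => p ∈ Q ∧ ¬ Leak p arm ∧ R p) =
      N (fun p : PtR ι ρ ν κ => p ∈ level0 Q k ∧ ¬ Leak p arm ∧ R p) +
        N (fun p : PtR ι ρ ν κ => p ∈ level1 Q k ∧ ¬ Leak p arm ∧ R (setF p k true)) := by
  rw [N_split_pred (fun p : PtR ι ρ ν κ => p ∈ Q ∧ ¬ Leak p arm ∧ R p)
    (fun p => p.2.2.2.2 k = false), N_level1_eq]
  congr 1
  apply N_congr
  intro p
  simp only [level0, Set.mem_setOf_eq]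
  tauto

/-- **The face induction**: the inequality on every face, the blue sets relative to the face. -/
theorem face_card_le (T : Finset κ) :
    ∀ (Q : Set (PtR ι ρ ν κ)), IsLowerSet Q → G5 Q → Q ⊆ face T →
      ∀ {𝓔 : Set (Set (AtomR ι ρ ν κ))}, IsUpperSet 𝓔 →
        N (fun p : PtR ι ρ ν κ => p ∈ Q ∧ ¬ Leak p arm ∧ ER p ∈ 𝓔) ≤
          N (fun p : PtR ι ρ ν κ => p ∈ Q ∧ ¬ Leak p arm ∧ EBT T p ∈ 𝓔) := by
  induction T using Finset.induction_on with
  | empty =>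
    intro Q hQ hG hf 𝓔 h𝓔
    unfold N
    convert face_empty_card_le hQ hG hf h𝓔 using 3
  | insert k T hk ih =>
    intro Q hQ hG hf 𝓔 h𝓔
    set 𝓔₁ : Set (Set (AtomR ι ρ ν κ)) := {S | insert (fA k) S ∈ 𝓔} with h𝓔₁
    have h𝓔₁def : ∀ S, S ∈ 𝓔₁ ↔ insert (fA k) S ∈ 𝓔 := fun S => Iff.rfl
    have h𝓔₁up : IsUpperSet 𝓔₁ := by
      intro S S' hSS' hS
      exact h𝓔 (Set.insert_subset_insert hSS') hS
    have h𝓔sub : ∀ S, S ∈ 𝓔 → S ∈ 𝓔₁ := fun S hS => h𝓔 (Set.subset_insert _ _) hS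
    have hQ0 := isLowerSet_level0 (k := k) hQ
    have hQ1 := isLowerSet_level1 (k := k) hQ
    have hG0 := G5_level0 (k := k) hG
    have hG1 := G5_level1 (k := k) hG
    have hf0 := level0_subset_face (k := k) hf
    have hf1 := level1_subset_face (k := k) hf
    -- the two counts by levels
    rw [N_levels (Q := Q) (k := k) (fun p => ER p ∈ 𝓔),
      N_levels (Q := Q) (k := k) (fun p => EBT (insert k T) p ∈ 𝓔)]
    -- level one, red: the far arm `k` is red there
    have eL1 : N (fun p : PtR ι ρ ν κ => p ∈ level1 Q k ∧ ¬ Leak p arm ∧ ER (setF p k true) ∈ 𝓔) =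
        N (fun p : PtR ι ρ ν κ => p ∈ level1 Q k ∧ ¬ Leak p arm ∧ ER p ∈ 𝓔₁) := by
      apply N_congr
      intro p
      rw [ER_setF_true, h𝓔₁def]
    -- level zero, blue: the far arm `k` is blue there
    have eR0 : N (fun p : PtR ι ρ ν κ => p ∈ level0 Q k ∧ ¬ Leak p arm ∧ EBT (insert k T) p ∈ 𝓔) =
        N (fun p : PtR ι ρ ν κ => p ∈ level0 Q k ∧ ¬ Leak p arm ∧ EBT T p ∈ 𝓔₁) := by
      apply N_congr
      intro p
      constructor
      · rintro ⟨hp, hL, hE⟩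
        refine ⟨hp, hL, ?_⟩
        rwa [EBT, flipT_insert_of_false hk hp.2, ER_setF_true] at hE
      · rintro ⟨hp, hL, hE⟩
        refine ⟨hp, hL, ?_⟩
        rw [EBT, flipT_insert_of_false hk hp.2, ER_setF_true]
        exact hE
    -- level one, blue: the far arm `k` is not blue there
    have eR1 : N (fun p : PtR ι ρ ν κ =>
        p ∈ level1 Q k ∧ ¬ Leak p arm ∧ EBT (insert k T) (setF p k true) ∈ 𝓔) =
        N (fun p : PtR ι ρ ν κ => p ∈ level1 Q k ∧ ¬ Leak p arm ∧ EBT T p ∈ 𝓔) := by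
      apply N_congr
      intro p
      constructor
      · rintro ⟨hp, hL, hE⟩
        refine ⟨hp, hL, ?_⟩
        rwa [EBT, flipT_insert_setF_true hk hp.1] at hE
      · rintro ⟨hp, hL, hE⟩
        refine ⟨hp, hL, ?_⟩
        rw [EBT, flipT_insert_setF_true hk hp.1]
        exact hE
    rw [eL1, eR0, eR1]
    have ih0 := ih (level0 Q k) hQ0 hG0 hf0 h𝓔
    have ih1 := ih (level1 Q k) hQ1 hG1 hf1 h𝓔₁up
    -- split the `𝓔₁` counts by `𝓔`
    have s0 := N_split_pred_sub (A := fun p : PtR ι ρ ν κ => p ∈ level0 Q k ∧ ¬ Leak p arm ∧ EBT T p ∈ 𝓔)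
      (B := fun p : PtR ι ρ ν κ => p ∈ level0 Q k ∧ ¬ Leak p arm ∧ EBT T p ∈ 𝓔₁)
      (fun p hp => ⟨hp.1, hp.2.1, h𝓔sub _ hp.2.2⟩)
    have s1 := N_split_pred_sub (A := fun p : PtR ι ρ ν κ => p ∈ level1 Q k ∧ ¬ Leak p arm ∧ EBT T p ∈ 𝓔)
      (B := fun p : PtR ι ρ ν κ => p ∈ level1 Q k ∧ ¬ Leak p arm ∧ EBT T p ∈ 𝓔₁)
      (fun p hp => ⟨hp.1, hp.2.1, h𝓔sub _ hp.2.2⟩)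
    have hdiff : N (fun p : PtR ι ρ ν κ =>
        (p ∈ level1 Q k ∧ ¬ Leak p arm ∧ EBT T p ∈ 𝓔₁) ∧ ¬ (p ∈ level1 Q k ∧ ¬ Leak p arm ∧ EBT T p ∈ 𝓔)) ≤
        N (fun p : PtR ι ρ ν κ =>
        (p ∈ level0 Q k ∧ ¬ Leak p arm ∧ EBT T p ∈ 𝓔₁) ∧ ¬ (p ∈ level0 Q k ∧ ¬ Leak p arm ∧ EBT T p ∈ 𝓔)) := by
      apply N_mono
      rintro p ⟨⟨h1, hL, hE⟩, hn⟩
      exact ⟨⟨level1_subset_level0 hQ h1, hL, hE⟩, fun h => hn ⟨h1, hL, h.2.2⟩⟩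
    omega

end Counting

section Main

variable [Nonempty ι] [Fintype ι] [DecidableEq ι] [Fintype ρ] [DecidableEq ρ] [Fintype ν]
  [DecidableEq ν] [Fintype κ] [DecidableEq κ] {arm : ν → ρ} {Q : Set (PtR ι ρ ν κ)}

/-- **THE SEVERAL-ARMS BIG-BLOCK LEMMA**: for every lower set `Q` of the several-arms raw cube
with `G5` (at least one u-arm) and every up-set `𝓔` of atom sets, the non-leaking part of `Q`
satisfies the rigid counting inequality — `BigBlock.mixedCore_card_le` for a junction with any
number of mixed arms, each with any number of pieces (pure arms included).  Proof: the face
induction `face_card_le` on the full face. -/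
theorem mixedArms_card_le (hQ : IsLowerSet Q) (hG : G5 Q) {𝓔 : Set (Set (AtomR ι ρ ν κ))}
    (h𝓔 : IsUpperSet 𝓔) :
    (Finset.univ.filter fun p : PtR ι ρ ν κ => p ∈ Q ∧ ¬ Leak p arm ∧ ER p ∈ 𝓔).card ≤
      (Finset.univ.filter fun p : PtR ι ρ ν κ => p ∈ Q ∧ ¬ Leak p arm ∧ EB p ∈ 𝓔).card := by
  have key := face_card_le (arm := arm) Finset.univ Q hQ hG (fun p _ => mem_face_univ p) h𝓔
  simp only [EBT_univ] at key
  unfold N at key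
  convert key using 3

end Main

end MixedArms

end Summit.Ventures.PercRepro2
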